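import Literature.Dynamics.Billiards.SlavedUnstablePlaques

/-!
# Synchronisation of contact instants on contact-slaved unstable plaques (D5)

Route `UGibbsSRBRigidity` of `AtomisticToContinuum/HydrodynamicLimit`, support item
stmt-AtomisticToContinuum-13992 (`GibbsStatesURegularSlaved`). Helper lemmas (`--supports`) that
machine-check the SYNCHRONISATION MECHANISM behind the negative lemma
`GibbsStatesURegularSlaved_false_of_LeafNullSlavedPlaques` (file `…/Negative/…`) and the evidence file
`SyncAbsorption.md` attached to the item:

* `SlavedSync.exists_Ico_not_mem_collisionEvents` — in a window trajectory
  (`Literature.Dynamics.Billiards.IsWindowTrajectory`, D4/D5's window clauses), a window particle with no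
  contact at the instant `s ≥ 0` has no contact on a whole interval `[s, b)`, `b > s` (local finiteness of
  contacts);
* `SlavedSync.snd_eq_of_not_mem_collisionEvents` — hence its velocity is CONSTANT on `[s, b]`
  (free flight anchored at right endpoints): no velocity jump off contact instants;
* `SlavedSync.mem_collisionEvents_of_jump` — **synchronisation lemma**: if the window path of `p` stays
  within sup phase-space distance `c` of a comparison path `rec` on a right neighbourhood of `s`
  (`dist` on `ℝ^d × ℝ^d` is the max of the position and velocity distances), and the velocity of `rec`
  has a right limit `w` at `s` with `‖w - (rec s).2‖ > 2c` (a jump exceeding `2c`), then `s` IS a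
  contact instant of `p`;
* `SlavedSync.norm_reflectVel_fst_sub` — the size of the elastic velocity jump is `|⟪v_p - v_q, n⟫| / ‖n‖`;
* `SlavedSync.reflectVel_fst_absorb` — ABSORPTION identity `(reflectVel n (v_p + b • n, v_q)).1 =
  (reflectVel n (v_p, v_q)).1`: an extra incoming normal velocity of a window particle is handed to its
  (exterior) partner and leaves the window system — plaques contain segments of distinct data, and the
  one-contact transfer map has rank `2d - 1`;
* `SlavedSync.sync_of_mem_slavedUnstableSet` — consequently, for every configuration `ω'` on the
  contact-slaved window plaque `slavedUnstableSet Φ Λ ω` of `ω`, with witnessing slaved trajectory `z` and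
  rate `r`: from some reversed time `S₀` on, every instant `s` at which the RECORDED reversed velocity of a
  window particle `p` jumps by more than `2 e^{-rs}` is an ACTUAL contact instant of `p` along `z` — the
  exponential-convergence clause of `slavedUnstableSet` (sup metric, all real `s ≥ S₀`) forces EXACT
  COINCIDENCE of the late contact instants, an infinite family of codimension-one constraints on the
  window data (the evidence file counts them: the plaque through `ω` is a countable union of
  `k`-dimensional pieces, `k` = number of window particles, inside `6k`-dimensional data, hence
  `μH[3k]`-null).

References: definitions D4/D5 (`InfiniteUnstablePlaques`, `SlavedUnstablePlaques`); folklore real analysis.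
-/

noncomputable section

open MeasureTheory Set Filter Metric Function Topology
open scoped InnerProductSpace
open Literature.Analysis.FunctionSpaces Literature.Analysis.FluidPDE Literature.Dynamics.Billiards

namespace Summit.AtomisticToContinuum.HydrodynamicLimit.Theorems

namespace SlavedSync

variable {d : Type*} [Fintype d]

variable {ε : ℝ} {W S : Set (EuclideanSpace ℝ d × EuclideanSpace ℝ d)}
  {z : EuclideanSpace ℝ d × EuclideanSpace ℝ d → ℝ → EuclideanSpace ℝ d × EuclideanSpace ℝ d}

/-- **No contact at `s` ⇒ no contact on some `[s, b)`.** In a window trajectory the contacts of window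
particles during `[0, s + 1]` are finitely many (`locFinite`), so a window particle `p` with no contact
at the instant `s ≥ 0` has none on a right neighbourhood `[s, b)`, `s < b`. -/
theorem exists_Ico_not_mem_collisionEvents (hz : IsWindowTrajectory ε W S z) {p : (EuclideanSpace ℝ d × EuclideanSpace ℝ d)} (hp : p ∈ W)
    {s : ℝ} (hs : 0 ≤ s) (hps : (p, s) ∉ collisionEvents ε S z) :
    ∃ b : ℝ, s < b ∧ ∀ τ ∈ Ico s b, (p, τ) ∉ collisionEvents ε S z := by
  classical
  set T : Set ℝ := {τ | τ ∈ Ioc s (s + 1) ∧ (p, τ) ∈ collisionEvents ε S z} with hT_def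
  have hT : T.Finite := by
    refine ((hz.locFinite (s + 1)).image Prod.snd).subset ?_
    rintro τ ⟨hτ, hev⟩
    exact ⟨(p, τ), ⟨hev, hp, ⟨hs.trans hτ.1.le, hτ.2⟩⟩, rfl⟩
  by_cases hne : T.Nonempty
  · obtain ⟨b, hbT, hbmin⟩ := T.exists_min_image id hT hne
    refine ⟨b, hbT.1.1, fun τ hτ hev => ?_⟩
    rcases eq_or_lt_of_le hτ.1 with h | h
    · exact hps (h ▸ hev)
    · have hτT : τ ∈ T := ⟨⟨h, hτ.2.le.trans hbT.1.2⟩, hev⟩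
      exact absurd (hbmin τ hτT) (not_le.2 hτ.2)
  · refine ⟨s + 1, by linarith, fun τ hτ hev => ?_⟩
    rcases eq_or_lt_of_le hτ.1 with h | h
    · exact hps (h ▸ hev)
    · exact hne ⟨τ, ⟨h, hτ.2.le⟩, hev⟩

/-- **Velocity is constant to the right of a non-contact instant.** If the window particle `p` has no
contact at `s ≥ 0`, there is `b > s` such that `(z p σ).2 = (z p s).2` for all `σ ∈ [s, b]` (free
flight anchored at the right endpoint `b`). -/
theorem snd_eq_of_not_mem_collisionEvents (hz : IsWindowTrajectory ε W S z) {p : (EuclideanSpace ℝ d × EuclideanSpace ℝ d)} (hp : p ∈ W)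
    {s : ℝ} (hs : 0 ≤ s) (hps : (p, s) ∉ collisionEvents ε S z) :
    ∃ b : ℝ, s < b ∧ ∀ σ ∈ Icc s b, (z p σ).2 = (z p s).2 := by
  obtain ⟨b, hsb, hfree⟩ := exists_Ico_not_mem_collisionEvents hz hp hs hps
  have key : ∀ σ ∈ Icc s b, (z p σ).2 = (z p b).2 := fun σ hσ => by
    rw [hz.free p hp σ b (hs.trans hσ.1) hσ.2 fun τ hτ => hfree τ ⟨hσ.1.trans hτ.1, hτ.2⟩]
  exact ⟨b, hsb, fun σ hσ => (key σ hσ).trans (key s ⟨le_rfl, hsb.le⟩).symm⟩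

/-- **Synchronisation lemma.** Let `z` be a window trajectory, `p` a window particle, `s ≥ 0`, and let
`rec : ℝ → ℝ^d × ℝ^d` be any comparison path whose velocity has the right limit `w` at `s`. If `z p`
stays within sup distance `c` of `rec` on a right neighbourhood `[s, s + η)` of `s` and the velocity jump
of `rec` at `s` exceeds `2c`, `‖w - (rec s).2‖ > 2c`, then `s` is a contact instant of `p` along `z`.
(Otherwise the velocity of `p` is constant to the right of `s`, so `‖w - (rec s).2‖ ≤
‖w - (z p s).2‖ + ‖(z p s).2 - (rec s).2‖ ≤ c + c`.) -/
theorem mem_collisionEvents_of_jump (hz : IsWindowTrajectory ε W S z) {p : (EuclideanSpace ℝ d × EuclideanSpace ℝ d)} (hp : p ∈ W)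
    {s : ℝ} (hs : 0 ≤ s) {rec : ℝ → (EuclideanSpace ℝ d × EuclideanSpace ℝ d)} {c : ℝ} {w : EuclideanSpace ℝ d}
    (hclose : ∀ᶠ σ in 𝓝[≥] s, dist (z p σ) (rec σ) ≤ c)
    (hw : Tendsto (fun σ => (rec σ).2) (𝓝[>] s) (𝓝 w))
    (hjump : 2 * c < dist w (rec s).2) :
    (p, s) ∈ collisionEvents ε S z := by
  by_contra hps
  have dist_snd_le_dist : ∀ a b : EuclideanSpace ℝ d × EuclideanSpace ℝ d, dist a.2 b.2 ≤ dist a b :=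
    fun a b => by rw [Prod.dist_eq]; exact le_max_right _ _
  obtain ⟨b, hsb, hconst⟩ := snd_eq_of_not_mem_collisionEvents hz hp hs hps
  -- at `s` itself
  have h0 : dist (z p s).2 (rec s).2 ≤ c :=
    (dist_snd_le_dist _ _).trans (hclose.self_of_nhdsWithin (mem_Ici.2 le_rfl))
  -- to the right of `s`: the velocity of `p` is frozen at `(z p s).2`
  have h1 : ∀ᶠ σ in 𝓝[>] s, dist (z p s).2 (rec σ).2 ≤ c := by
    have hIoo : Ioo s b ∈ 𝓝[>] s := Ioo_mem_nhdsGT hsb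
    filter_upwards [nhdsWithin_mono s Ioi_subset_Ici_self hclose, hIoo] with σ hσ hσb
    rw [← hconst σ ⟨hσb.1.le, hσb.2.le⟩]
    exact (dist_snd_le_dist _ _).trans hσ
  have h2 : dist (z p s).2 w ≤ c :=
    le_of_tendsto (tendsto_const_nhds.dist hw) h1
  have h3 : dist w (rec s).2 ≤ c + c := by
    calc dist w (rec s).2 ≤ dist w (z p s).2 + dist (z p s).2 (rec s).2 := dist_triangle _ _ _
      _ ≤ c + c := add_le_add (by rwa [dist_comm]) h0
  linarith

omit [Fintype d] in
/-- **Size of the elastic velocity jump**: for the reflection law `reflectVel n (v_p, v_q)` the outgoing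
minus incoming velocity of the first particle has norm `|⟪v_p - v_q, n⟫| / ‖n‖` (the normal relative
speed when `‖n‖ = ε` is the contact vector). -/
theorem norm_reflectVel_fst_sub {E : Type*} [NormedAddCommGroup E] [InnerProductSpace ℝ E] {n : E}
    (hn : n ≠ 0) (v : E × E) : ‖(reflectVel n v).1 - v.1‖ = |⟪v.1 - v.2, n⟫_ℝ| / ‖n‖ := by
  have hn' : ‖n‖ ≠ 0 := norm_ne_zero_iff.2 hn
  simp only [reflectVel, sub_sub_cancel_left, norm_neg, norm_smul, Real.norm_eq_abs, abs_div,
    abs_pow, abs_norm]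
  field_simp

omit [Fintype d] in
/-- **Absorption identity** (the equal-mass law forgets the incoming NORMAL velocity of the reflected
particle): adding a multiple of the contact vector `n` to the incoming velocity of the first particle
does not change its outgoing velocity, `(reflectVel n (v_p + b • n, v_q)).1 = (reflectVel n (v_p, v_q)).1`
— the normal components are exchanged, so the first particle's outgoing normal velocity is the partner's
incoming one. In the contact-slaved window dynamics (D5) the partner is an EXTERIOR particle whose path is
never constrained again: a window datum arriving at a recorded space-time contact point with an extra
normal velocity `b • n` is back on its record immediately after the contact (its error is absorbed by
the exterior), so every plaque contains, with the recorded datum `(q, v)`, the segment of data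
`(q - s₁ b • n, v + b • n)` (`s₁` the first recorded exterior contact of that particle, `|b|` small) —
the one-contact transfer map of the window particle has rank `2d - 1`, not `2d`. -/
theorem reflectVel_fst_absorb {E : Type*} [NormedAddCommGroup E] [InnerProductSpace ℝ E] (n : E)
    (v : E × E) (b : ℝ) : (reflectVel n (v.1 + b • n, v.2)).1 = (reflectVel n v).1 := by
  by_cases hn : n = 0
  · subst hn
    simp
  have hn2 : ‖n‖ ^ 2 ≠ 0 := pow_ne_zero 2 (norm_ne_zero_iff.2 hn)
  simp only [reflectVel]
  rw [show v.1 + b • n - v.2 = (v.1 - v.2) + b • n by abel, inner_add_left, inner_smul_left,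
    real_inner_self_eq_norm_sq, RCLike.conj_to_real, add_div, mul_div_assoc, div_self hn2, mul_one,
    add_smul]
  abel

variable {Φ : InfiniteHardSphereFlow d ε} {Λ : Set (EuclideanSpace ℝ d)}
  {ω ω' : PointConfig (EuclideanSpace ℝ d × EuclideanSpace ℝ d)}

/-- **Synchronisation on contact-slaved plaques.** Let `ω'` lie on the contact-slaved window-`Λ` plaque
of `ω` (`slavedUnstableSet Φ Λ ω`, D5). Then `ω` is good and there are a slaved trajectory `z` implanting
to `ω'`, a rate `r > 0` and a time `S₀` such that for every window particle `p`, every reversed instant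
`s ≥ max S₀ 0` and every right limit `w` of the RECORDED reversed velocity of `p` at `s` with jump
`‖w - (revTraj Φ ω p s).2‖ > 2 e^{-rs}`, the instant `s` is an ACTUAL contact instant of `p` along `z`:
late contacts of the window path are synchronised with the recorded ones. -/
theorem sync_of_mem_slavedUnstableSet (h : ω' ∈ slavedUnstableSet Φ Λ ω) :
    ω ∈ Φ.good ∧ ∃ z : (EuclideanSpace ℝ d × EuclideanSpace ℝ d) → ℝ → (EuclideanSpace ℝ d × EuclideanSpace ℝ d),
      IsSlavedTrajectory ε (windowLabels Λ ω : Set (EuclideanSpace ℝ d × EuclideanSpace ℝ d)) (ω : Set (EuclideanSpace ℝ d × EuclideanSpace ℝ d)) (revTraj Φ ω) z ∧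
      ω' = implant Λ ω (fun p : ↥(windowLabels Λ ω) => revPhase (z p 0)) ∧
      ∃ r S₀ : ℝ, 0 < r ∧ ∀ p ∈ windowLabels Λ ω, ∀ s : ℝ, S₀ ≤ s → 0 ≤ s → ∀ w : EuclideanSpace ℝ d,
        Tendsto (fun σ => (revTraj Φ ω p σ).2) (𝓝[>] s) (𝓝 w) →
        2 * Real.exp (-(r * s)) < dist w (revTraj Φ ω p s).2 →
          (p, s) ∈ collisionEvents ε (ω : Set (EuclideanSpace ℝ d × EuclideanSpace ℝ d)) z := by
  obtain ⟨hω, z, hz, ⟨r, hr, hconv⟩, hω'⟩ := h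
  obtain ⟨S₀, hS₀⟩ := eventually_atTop.1 hconv
  refine ⟨hω, z, hz, hω', r, S₀, hr, fun p hp s hS₀s hs w hw hjump => ?_⟩
  refine mem_collisionEvents_of_jump hz.toIsWindowTrajectory (Finset.mem_coe.2 hp) hs ?_ hw hjump
  filter_upwards [self_mem_nhdsWithin] with σ hσ
  refine (hS₀ σ (hS₀s.trans hσ) p hp).trans (Real.exp_le_exp.2 ?_)
  exact neg_le_neg (mul_le_mul_of_nonneg_left hσ hr.le)

/-- **The recorded jumps that must be matched.** At a recorded (reversed) contact of the window particle
`p` with another particle `q` of the good configuration `ω` at the instant `s ≥ 0`, the recorded reversed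
velocity of `p` has the right limit `(reflectVel n (v_p, v_q)).1`, `n` the contact vector, and the jump
has norm `|⟪v_p - v_q, n⟫| / ‖n‖` — the normal relative speed, bounded away from `0` for a non-grazing
collision; with `sync_of_mem_slavedUnstableSet` every such late recorded contact with normal relative
speed `> 2 e^{-rs}` is an actual contact instant of `p` on every configuration of the plaque. -/
theorem recorded_jump (hω : ω ∈ Φ.good) {p : (EuclideanSpace ℝ d × EuclideanSpace ℝ d)} (hp : p ∈ windowLabels Λ ω) {q : (EuclideanSpace ℝ d × EuclideanSpace ℝ d)}
    (hq : q ∈ (ω : Set (EuclideanSpace ℝ d × EuclideanSpace ℝ d))) (hpq : p ≠ q) {s : ℝ} (hs : 0 ≤ s)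
    (hcontact : ‖(revTraj Φ ω p s).1 - (revTraj Φ ω q s).1‖ = ε) (hε : 0 < ε) :
    Tendsto (fun σ => (revTraj Φ ω p σ).2) (𝓝[>] s)
        (𝓝 (reflectVel ((revTraj Φ ω p s).1 - (revTraj Φ ω q s).1)
          ((revTraj Φ ω p s).2, (revTraj Φ ω q s).2)).1) ∧
      dist (reflectVel ((revTraj Φ ω p s).1 - (revTraj Φ ω q s).1)
          ((revTraj Φ ω p s).2, (revTraj Φ ω q s).2)).1 (revTraj Φ ω p s).2 =
        |⟪(revTraj Φ ω p s).2 - (revTraj Φ ω q s).2,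
            (revTraj Φ ω p s).1 - (revTraj Φ ω q s).1⟫_ℝ| / ε := by
  have hrec := (isSlavedTrajectory_revTraj (Λ := Λ) hω).collision p (Finset.mem_coe.2 hp) q hq hpq s
    hs hcontact
  refine ⟨hrec.2.2, ?_⟩
  have hn : (revTraj Φ ω p s).1 - (revTraj Φ ω q s).1 ≠ 0 := by
    intro h0
    rw [h0, norm_zero] at hcontact
    exact hε.ne hcontact
  rw [dist_eq_norm, norm_reflectVel_fst_sub hn, hcontact]

end SlavedSync

end Summit.AtomisticToContinuum.HydrodynamicLimit.Theorems
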